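import Summits.QuantumFields.YangMills.Theorems.BalabanUVNodesN18KingModelU3Rung

/-!
# BalabanUVNodes ∕ N18 — (0.25) IN KING'S MODEL: the ONE-RUN ENVELOPES `T4OutputRate.DecayBound` WITH `κ > 0` of King's
# ACTUAL (4.42) three-factor graphs on Bałaban's tori, any carriers, at ONE letter set with `NE5` — every hypothesis shape of
# `T4OutputRate` §2 inhabited at once (Track A, DAG node N18 = NE5 `T4OutputRate.NE5 EA EB W κ θ C₅` :211; director-ym R134
# row n18 s3 «King-model transfer `N18KingModelTorus` (κ, C₅ from (d, L, a, m², γ)) → `TwoRunTorusNE5Final*`», module 5a of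
# seat pub-ymgap-dag-n18-e; modules 5b `N18KingModelOneRunReadouts` ∕ 5c `N18KingModelFinePoints` carry it to the END's carriers)

HONEST FRAMING.  Count-neutral kernel bookkeeping (seat pub-ymgap-dag-n18-e g5, strategy s3; `--supports` K3′
`SpineGivenEndpointR12`, helper).  King's `A = 0` scalar MODEL ([King1986], printed and proved, typed by seats n18-a∕n18-b) —
NOT Bałaban's covariant one-step outputs `E^{(j)}(X; g, U_k(V))` of [Balaban1987RG1] (0.24)∕(2.13), for which NE5 is NOT IN
PRINT and has no tree producer (NODE O instance 0∕1); NOT a node discharge; finite tori; nothing continuum ∕ ℝ⁴ ∕ OS ∕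
mass-gap ∕ Clay.  THEOREMS ONLY: 0 `def`, 0 `sorry`, standard axioms.

THE POINT.  [Balaban1987RG1] p. 257 prints the localization expansion (0.24) `E^{(j)} = Σ_{X ∈ 𝐃_j} E^{(j)}(X)` TOGETHER WITH
the one-run envelope (0.25) `|E^{(j)}(X; g, U)| ≤ E₀ e^{−κd_j(X)}` (typed `T4OutputRate.DecayBound E W E₀ κ`, (1.18) p. 263),
and the cell's unprinted NE5 is the two-run rate AT THE SAME DECAY LETTER `κ`: the END's junction
`TwoRunTorusNE5.ne5_of_torus_rates_all_scales` asks the one-run envelopes `‖E_A‖, ‖E_B‖ ≤ A e^{−κ′d}` next to the two-run rate,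
node U3 (`T4OutputRate.u3_threeBrackets`) and N18's N10 ∕ NODE-A in-edge read `DecayBound` at NE5's `κ`, and
`N18End.ne5_of_decayBounds_one_le` shows that envelopes alone give NE5 only with `θ ≥ 1`.  The n18-a∕-e lineage typed NE5
for King's graphs (p418046 `ne5_kingModel_threeFactor_torus`; on the END's carriers p458808∕p459720∕p465902∕p469937∕p470068,
the polymer representation (0.24)) but the one-run envelope only with `κ = 0` (`N18KingModel.decayBound_of_kingModel_A∕_B`,
King's uniform size bound) or for the top piece alone (`N18KingModelTopPiece.decayBound_topPiece_A∕_B`).  THIS FILE types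
(0.25) WITH DECAY for the (4.42) graphs — King's Theorem 3.3 decay of both outer minimiser lines and the (4.34) decay of the
middle covariance, convolved — at a decay letter SHARED with NE5:
* §1 (generic, any carriers) `decayBound_mono` (the shape is monotone in its letters) and **`decayBound_of_threeFactorDecay`**
  — the one-run twin of `N18KingModelScales.ne5_of_threeFactorRates`: a three-factor read-out `u(X) ⬝ (E(X) v(X))` whose row,
  kernel and column decay at rate `κ` through positions with `d X ≤ ρ(p X, r X)` obeys `DecayBound F W (a·c·b·V²) (κ∕2)`
  (`N18KingModelScales.bilin_decay_bound`, King's (4.41)).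
* §2 (King's ACTUAL operators on Bałaban's tori, the binder list of p418046 VERBATIM) **`decayBound_kingModel_threeFactor_torus`**
  — `∃ κ > 0, A ≥ 0` (functions of `d, L, a, m²` only; `γ`-free) with `DecayBound EA W A κ ∧ DecayBound EB W A κ` for run A's
  `Σ_{z,w} ℋ_j(x_A,z)C^{(j)}(z,w)ℋ_j(y_A,w)` and run B's graph on level `j + n` (`minimiser_row_decay` ∕ `minimiser_col_decay`
  of n18-b's `King1986/MinimizerBlockDecay` — Theorem 3.3 in block distance —, `king_cov_decay_torus` — (4.34) —,
  `tdistT_sumBound`, `blockOf_over`); and **`kingModel_threeFactor_allShapes_torus`** — ONE LETTER SET: `∃ κ > 0, A, C₅ ≥ 0`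
  with `DecayBound EA W A κ ∧ DecayBound EB W A κ ∧ NE5 EA EB W κ (L^{−γ∕2}) C₅` (p418046 at the common `κ`, `N18Knit.ne5_mono`)
  `∧ PrefixDependenceOn EA W ∧ NE9 EA W κ 0 ∧ LipBackground EA W κ 0` (the zero letters of a coupling- and background-blind
  functional, `N18Coherence.ne9_zero_of_couplingBlind`, `N18KingModelU3Rung.lipBackground_zero_iff_unreadOn`): EVERY
  hypothesis shape of `T4OutputRate` §2 inhabited by King's actual graphs at once — the located content is (0.25)'s `κ > 0`
  and NE5's `θ < 1`, the located ABSENCE is the zero Lipschitz ∕ history letters (what Bałaban's `V`-dependence adds, p450669).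
* Module 5b (`N18KingModelOneRunReadouts`) carries §2 to the line-indexed carriers of p469937 §3 (`abs_kingGraph_le_of_readings`:
  `|G_A(l)|, |G_B(l)| ≤ A·e^{−κ|B(x_A l) − B(y_A l)|_{T₁}}` per line) and to configuration-dependent read-outs on the END's carriers
  `torusCarriers` ∕ `reFunctional` (the one-run twins of p469937 §2, in `DecayBound` form and in the END's complex currency
  `‖E j X φ‖ ≤ A e^{−κ′ d_j(X)}` — the `hA1`∕`hB1` slots of `TwoRunTorusNE5.ne5_of_torus_rates_all_scales`, the `hE0`∕`hE1` slots
  of `TwoRunTorusNE5Final8.ne5_end_final_all8`); module 5c (`N18KingModelFinePoints`) puts them together with p470068's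
  construction: the polymer-representation activities carry (0.25) at NE5's own `κ∕8`, with ALL fine points read.
WHAT THIS DOES NOT DO.  `A = 0`, `g`∕`U` unread (the Lipschitz ∕ history letters ARE zero here — that is the point of the
`allShapes` conjuncts, not a claim about Bałaban's outputs); periodic b.c.; King's (2.20)-rescaling and vertex functions outside;
NOT Bałaban's `E^{(j)}(X; g, U)`.

Sources: C. King, Commun. Math. Phys. **102** (1986) 649–677 [King1986] — Thm 3.3 (3.7) p. 658, Prop. 3.7 (3.64) p. 663,
(4.33)–(4.34) p. 674, (4.41)–(4.43) p. 675, Prop. 3.9 (3.73) p. 665; T. Bałaban, Commun. Math. Phys. **109** (1987) 249–301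
[Balaban1987RG1] — (0.24)–(0.25) p. 257, (1.18) p. 263, Thm 1 p. 259, §0 p. 256 ∕ §5 p. 298 (prefix dependence); **119**
(1988) 243–285 [Balaban1988Convergent] (2.27)(ii) p. 259 (background Lipschitz shape).  No claim about the mass gap.
-/

noncomputable section

namespace Summit.QuantumFields.YangMills.BalabanUVNodes.N18KingModelOneRun

open Real Matrix
open Literature.MathematicalPhysics.QuantumFieldTheory.Balaban1983to89 (Params)
open Literature.MathematicalPhysics.QuantumFieldTheory.Balaban1983to89
open Literature.MathematicalPhysics.QuantumFieldTheory.Balaban1983to89.T4OutputRate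
  (Carriers Functional NE5 DecayBound PrefixDependenceOn NE9 LipBackground)
open Literature.MathematicalPhysics.QuantumFieldTheory.Balaban1983to89.B5Prop11Plancherel (Tor fine)
open Literature.MathematicalPhysics.QuantumFieldTheory.Balaban1983to89.B4Sect5Proof (latticeConst latticeConst_nonneg)
open Literature.MathematicalPhysics.QuantumFieldTheory.King1986 (aK exp_decay_mono)
open Literature.MathematicalPhysics.QuantumFieldTheory.King1986.Torus
  (minimiser effLaplacian blockProj blockOf blockOf_over tdistT tdistT_symm tdistT_nonneg tdistT_isPseudoDist
    tdistT_sumBound gam0L gam0L_pos kapCT kapCT_pos_le aminL_le_aK minimiser_row_decay minimiser_col_decay)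
open Summit.QuantumFields.YangMills.BalabanUVNodes.N18KingModel (kingTheta_pos)
open Summit.QuantumFields.YangMills.BalabanUVNodes.N18KingModelScales (bilin_decay_bound king_cov_decay_torus)
open Summit.QuantumFields.YangMills.BalabanUVNodes.N18KingModelTorus (ne5_kingModel_threeFactor_torus)
open Summit.QuantumFields.YangMills.BalabanUVNodes.N18Knit (ne5_mono)
open Summit.QuantumFields.YangMills.BalabanUVNodes.N18Coherence (ne9_zero_of_couplingBlind)
open Summit.QuantumFields.YangMills.BalabanUVNodes.N18KingModelU3Rung (lipBackground_zero_iff_unreadOn)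

/-! ## §1 The one-run envelope shape: monotone in its letters; three-factor read-outs with decaying factors -/

section Generic

variable {C : Carriers}

/-- **`DecayBound` is monotone in its letters**: a smaller window, a smaller decay rate `κ′ ≤ κ` and a larger constant
`E₀′ ≥ E₀` preserve the one-run envelope (tree lengths are nonnegative, `Carriers.d_nonneg`). [cite: Balaban1987RG1, (1.18) p.263] -/
theorem decayBound_mono {Bg : Type} {E : Functional C Bg} {W W' : Set (ℕ → ℝ)} {E₀ E₀' κ κ' : ℝ}
    (h : DecayBound E W E₀ κ) (hW : W' ⊆ W) (hκ : κ' ≤ κ) (hE : E₀ ≤ E₀') : DecayBound E W' E₀' κ' := by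
  intro g hg U X
  have h0 := h g (hW hg) U X
  have hE₀ : 0 ≤ E₀ := by
    have h1 : 0 ≤ E₀ * Real.exp (-(κ * C.d X)) := (abs_nonneg _).trans h0
    exact nonneg_of_mul_nonneg_left (by rwa [mul_comm] at h1) (Real.exp_pos _)
  have h2 : Real.exp (-(κ * C.d X)) ≤ Real.exp (-(κ' * C.d X)) :=
    Real.exp_le_exp.2 (by nlinarith [C.d_nonneg X])
  exact h0.trans (mul_le_mul hE h2 (Real.exp_pos _).le (hE₀.trans hE))

variable {β : ℕ → Type*} [∀ j, Fintype (β j)] {P : ℕ → Type*}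

/-- **(0.25) FOR A THREE-FACTOR READ-OUT WITH DECAYING FACTORS** (the one-run twin of
`N18KingModelScales.ne5_of_threeFactorRates`).  Any carriers `C`; a domain `X` of scale `j` reads positions `p X`, `r X` on the
scale-`j` position space with `C.d X ≤ ρ_j(p X, r X)`; the functional at `X` is the (4.42) three-factor read-out
`u(X) ⬝ (E(X) v(X))` over the scale-`j` summation lattice; the row decays from `p X`, the kernel between its arguments, the
column towards `r X`, all at rate `κ` (sizes `a, c, b`), lattice sums `V` uniform in the scale ⟹ `DecayBound F W (a·c·b·V²) (κ∕2)`
— the printed one-run envelope shape with HALF the factors' decay rate.  `W`, backgrounds unread (A = 0 model).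
[cite: King1986, (4.41) p.675, Thm 3.3 p.658; Balaban1987RG1, (0.25) p.257] -/
theorem decayBound_of_threeFactorDecay (ρ : (j : ℕ) → P j → P j → ℝ) (hρ0 : ∀ j p q, 0 ≤ ρ j p q)
    (hρtri : ∀ j p q r, ρ j p r ≤ ρ j p q + ρ j q r) (q : (j : ℕ) → β j → P j)
    (p r : (X : C.Dom) → P (C.scale X)) (u v : (X : C.Dom) → β (C.scale X) → ℝ)
    (E : (X : C.Dom) → Matrix (β (C.scale X)) (β (C.scale X)) ℝ)
    {κ a c b V : ℝ} (hκ : 0 ≤ κ) (ha : 0 ≤ a) (hc : 0 ≤ c) (hb : 0 ≤ b)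
    (hu : ∀ X z, |u X z| ≤ a * Real.exp (-(κ * ρ _ (p X) (q _ z))))
    (hE : ∀ X z w, |E X z w| ≤ c * Real.exp (-(κ * ρ _ (q _ z) (q _ w))))
    (hv : ∀ X w, |v X w| ≤ b * Real.exp (-(κ * ρ _ (q _ w) (r X))))
    (hV : ∀ j (s : P j), ∑ z, Real.exp (-(κ / 2 * ρ j s (q j z))) ≤ V)
    (hd : ∀ X, C.d X ≤ ρ _ (p X) (r X))
    {Bg : Type} (F : Functional C Bg) (hF : ∀ g U X, F g U X = u X ⬝ᵥ (E X *ᵥ v X)) (W : Set (ℕ → ℝ)) :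
    DecayBound F W (a * c * b * V ^ 2) (κ / 2) := by
  intro g _ U X
  rw [hF]
  have h := bilin_decay_bound (ρ (C.scale X)) (hρ0 _) (hρtri _) (q _) (p X) (r X) (u X) (v X) (E X) hκ ha hc hb
    (hu X) (hE X) (hv X) (hV _)
  refine h.trans ?_
  have hV0 : 0 ≤ V := (Finset.sum_nonneg fun z _ => (Real.exp_pos _).le).trans (hV _ (p X))
  have hK : 0 ≤ a * c * b * V ^ 2 := by positivity
  have hexp : Real.exp (-(κ / 2 * ρ _ (p X) (r X))) ≤ Real.exp (-(κ / 2 * C.d X)) :=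
    Real.exp_le_exp.mpr (neg_le_neg (mul_le_mul_of_nonneg_left (hd X) (by positivity)))
  exact mul_le_mul_of_nonneg_left hexp hK

end Generic

/-! ## §2 (0.25) for King's ACTUAL (4.42) graphs on Bałaban's tori, and the full letter set with `NE5` -/

section KingTorus

variable {d : ℕ}

/-- **(0.25) WITH DECAY FOR KING'S ACTUAL THREE-FACTOR GRAPHS ON BAŁABAN'S TORI — UNCONDITIONAL.**  For `d ≥ 1`, odd `L > 1`,
`a > 0`, `m² > 0` there are `κ > 0` and `A ≥ 0` (functions of `d, L, a, m²` ONLY — no `γ`: the one-run envelope has no rate)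
such that, on the binder list of p418046 `N18KingModelTorus.ne5_kingModel_threeFactor_torus` VERBATIM (every `n ≥ 1`; every
scale-indexed family of unit tori `L·M_j(μ) = 2L^{m_j}`; every carriers `C` with `1 ≤ scale X` whose domains read run-A fine
points `x_A(X), y_A(X)` UNDER run-B's `x_B(X), y_B(X)` and a tree length `d X ≤ |B(x_A) − B(y_A)|_{T₁}`; every functionals
reading run A's `Σ_{z,w} ℋ_j(x_A, z)·C^{(j)}(z, w)·ℋ_j(y_A, w)` and run B's `Σ_{z,w} ℋ_{j+n}(x_B, z)·C^{(j+n)}(z, w)·ℋ_{j+n}(y_B, w)`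
with King's ACTUAL `A = 0` operators `ℋ = minimiser`, `C^{(·)} = (effLaplacian + aL⁻²·blockProj)⁻¹`; every window):
**`DecayBound EA W A κ ∧ DecayBound EB W A κ`** — `|E_A(X)|, |E_B(X)| ≤ A·e^{−κ·d X}` at EVERY domain, ONE `(A, κ)` for all
scales, volumes and both runs.  Composition: §1 twice, rows `minimiser_row_decay` (Theorem 3.3 in block distance), columns
`minimiser_col_decay` (run B's blocks under `x_B, y_B` are `B(x_A), B(y_A)`: `blockOf_over`), middle `king_cov_decay_torus`
((4.34), weakened from `κ′ = kapCT` to the common rate), lattice sums `tdistT_sumBound`; `κ = ½·min(δ₀^{row}, δ₀^{col}, κ′)`.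
[cite: King1986, Thm 3.3 (3.7) p.658, Prop. 3.7 (3.64) p.663, (4.33)–(4.34) p.674, (4.41)–(4.42) p.675; Balaban1987RG1, (0.25) p.257, (1.18) p.263] -/
theorem decayBound_kingModel_threeFactor_torus (hd : 1 ≤ d) (L : ℕ) [NeZero L] (hLp : Odd L ∧ 1 < L) {a m2 : ℝ}
    (ha : 0 < a) (hm : 0 < m2) :
    ∃ κ A : ℝ, 0 < κ ∧ 0 ≤ A ∧
      ∀ (n : ℕ) (_hn : 1 ≤ n) (M : ℕ → Fin d → ℕ) [∀ j μ, NeZero (M j μ)]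
        (_hM : ∀ j, ∃ mm : ℕ, ∀ μ, L * M j μ = 2 * L ^ mm)
        (C : Carriers) (_hsc : ∀ X, 1 ≤ C.scale X)
        (xA yA : (X : C.Dom) → Tor (fine (L ^ C.scale X) (fine L (M (C.scale X)))))
        (xB yB : (X : C.Dom) → Tor (fine (L ^ n * L ^ C.scale X) (fine L (M (C.scale X)))))
        (_hx : ∀ X μ, (xA X μ).val = (xB X μ).val / L ^ n)
        (_hy : ∀ X μ, (yA X μ).val = (yB X μ).val / L ^ n)
        (_hd : ∀ X, C.d X ≤ tdistT (fine L (M (C.scale X)))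
            (blockOf (L ^ C.scale X) (fine L (M (C.scale X))) (xA X))
            (blockOf (L ^ C.scale X) (fine L (M (C.scale X))) (yA X)))
        (EA : Functional C C.BgA) (EB : Functional C C.BgB)
        (_hEA : ∀ g U X, EA g U X =
          (fun z => minimiser (L ^ C.scale X) (fine L (M (C.scale X))) (aK a L (C.scale X))
              (((L ^ C.scale X : ℕ) : ℝ) ^ 2) m2 (Pi.single z 1) (xA X))
            ⬝ᵥ ((effLaplacian (L ^ C.scale X) (fine L (M (C.scale X))) (aK a L (C.scale X))
                    (((L ^ C.scale X : ℕ) : ℝ) ^ 2) m2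
                  + (a * ((L : ℝ) ^ 2)⁻¹) • blockProj L (M (C.scale X)))⁻¹
                *ᵥ fun w => minimiser (L ^ C.scale X) (fine L (M (C.scale X))) (aK a L (C.scale X))
                    (((L ^ C.scale X : ℕ) : ℝ) ^ 2) m2 (Pi.single w 1) (yA X)))
        (_hEB : ∀ g U X, EB g U X =
          (fun z => minimiser (L ^ n * L ^ C.scale X) (fine L (M (C.scale X))) (aK a L (C.scale X + n))
              (((L ^ n * L ^ C.scale X : ℕ) : ℝ) ^ 2) m2 (Pi.single z 1) (xB X))
            ⬝ᵥ ((effLaplacian (L ^ n * L ^ C.scale X) (fine L (M (C.scale X))) (aK a L (C.scale X + n))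
                    (((L ^ n * L ^ C.scale X : ℕ) : ℝ) ^ 2) m2
                  + (a * ((L : ℝ) ^ 2)⁻¹) • blockProj L (M (C.scale X)))⁻¹
                *ᵥ fun w => minimiser (L ^ n * L ^ C.scale X) (fine L (M (C.scale X))) (aK a L (C.scale X + n))
                    (((L ^ n * L ^ C.scale X : ℕ) : ℝ) ^ 2) m2 (Pi.single w 1) (yB X)))
        (W : Set (ℕ → ℝ)),
        DecayBound EA W A κ ∧ DecayBound EB W A κ := by
  have hL2 : 2 ≤ L := by have := hLp.2; omega
  -- the outer-line packages of n18-b (Theorem 3.3 in block-distance currency), BY NAME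
  obtain ⟨δ₁, c₁, hδ₁, hc₁, H₁⟩ := minimiser_row_decay d L hd hLp ha hm.le
  obtain ⟨δ₂, c₂, hδ₂, hc₂, H₂⟩ := minimiser_col_decay d L hd hLp ha hm.le
  -- one common decay rate for the outer lines and the middle line
  obtain ⟨hκ'0, _⟩ := kapCT_pos_le (d := d) ha hL2
  set κ : ℝ := min (min δ₁ δ₂) (kapCT d a L) with hκ_def
  have hκpos : 0 < κ := lt_min (lt_min hδ₁ hδ₂) hκ'0
  have hκ₁ : κ ≤ δ₁ := (min_le_left _ _).trans (min_le_left _ _)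
  have hκ₂ : κ ≤ δ₂ := (min_le_left _ _).trans (min_le_right _ _)
  have hκ' : κ ≤ kapCT d a L := min_le_right _ _
  have hγ₀ : 0 < gam0L d a L := gam0L_pos ha hL2
  have hsC : 0 ≤ 2 / gam0L d a L := by positivity
  have hsA : 0 ≤ a * c₁ := by positivity
  have hsB : 0 ≤ a * c₂ := by positivity
  have hKd : 0 ≤ latticeConst d (κ / 2) := latticeConst_nonneg d (half_pos hκpos).le
  refine ⟨κ / 2, a * c₁ * (2 / gam0L d a L) * (a * c₂) * (latticeConst d (κ / 2)) ^ 2, half_pos hκpos,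
    by positivity, ?_⟩
  intro n hn M _ hM C hsc xA yA xB yB hx hy hdd EA EB hEA hEB W
  -- the volume letters of a scale, in n18-b's `Params` currency
  have hPar : ∀ (X : C.Dom) (k : ℕ), ∃ mm : ℕ, ∀ μ, fine L (M (C.scale X)) μ
      = (⟨d, L, mm, k, hd, hLp⟩ : Params).sitesPerDir k := by
    intro X k
    obtain ⟨mm, hmm⟩ := hM (C.scale X)
    exact ⟨mm, fun μ => by simp only [Params.sitesPerDir, Nat.add_sub_cancel]; exact hmm μ⟩
  -- the middle factors' decay BY NAME (`king_cov_decay_torus`), weakened from `κ′` to `κ`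
  have hCA : ∀ (X : C.Dom) z w, |(effLaplacian (L ^ C.scale X) (fine L (M (C.scale X))) (aK a L (C.scale X))
        (((L ^ C.scale X : ℕ) : ℝ) ^ 2) m2 + (a * ((L : ℝ) ^ 2)⁻¹) • blockProj L (M (C.scale X)))⁻¹ z w|
      ≤ 2 / gam0L d a L * Real.exp (-(κ * tdistT _ z w)) := by
    intro X z w
    obtain ⟨hlo, hhi⟩ := aminL_le_aK ha hL2 (hsc X)
    exact (king_cov_decay_torus ha hm hL2 (L ^ C.scale X) hlo hhi (M (C.scale X)) z w).trans
      (exp_decay_mono hsC hκ' ((tdistT_isPseudoDist _).nonneg z w))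
  have hCB : ∀ (X : C.Dom) z w, |(effLaplacian (L ^ n * L ^ C.scale X) (fine L (M (C.scale X)))
        (aK a L (C.scale X + n)) (((L ^ n * L ^ C.scale X : ℕ) : ℝ) ^ 2) m2
        + (a * ((L : ℝ) ^ 2)⁻¹) • blockProj L (M (C.scale X)))⁻¹ z w|
      ≤ 2 / gam0L d a L * Real.exp (-(κ * tdistT _ z w)) := by
    intro X z w
    obtain ⟨hlo, hhi⟩ := aminL_le_aK ha hL2 (show 1 ≤ C.scale X + n by have := hsc X; omega)
    exact (king_cov_decay_torus ha hm hL2 (L ^ n * L ^ C.scale X) hlo hhi (M (C.scale X)) z w).trans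
      (exp_decay_mono hsC hκ' ((tdistT_isPseudoDist _).nonneg z w))
  -- the lattice sums BY NAME (uniform in the torus)
  have hV : ∀ (j : ℕ) (s : Tor (fine L (M j))),
      ∑ z, Real.exp (-(κ / 2 * tdistT (fine L (M j)) s (id z))) ≤ latticeConst d (κ / 2) :=
    fun j s => tdistT_sumBound (fine L (M j)) (κ / 2) (half_pos hκpos) s
  constructor
  · -- run A: row and column of `ℋ_j` at level `j = scale X` (Theorem 3.3), middle `C^{(j)}`
    refine decayBound_of_threeFactorDecay (C := C) (β := fun j => Tor (fine L (M j))) (P := fun j => Tor (fine L (M j)))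
      (fun j => tdistT (fine L (M j))) (fun j => (tdistT_isPseudoDist _).nonneg)
      (fun j => (tdistT_isPseudoDist _).triangle) (fun _ => id)
      (fun X => blockOf (L ^ C.scale X) (fine L (M (C.scale X))) (xA X))
      (fun X => blockOf (L ^ C.scale X) (fine L (M (C.scale X))) (yA X))
      (fun X z => minimiser (L ^ C.scale X) (fine L (M (C.scale X))) (aK a L (C.scale X))
        (((L ^ C.scale X : ℕ) : ℝ) ^ 2) m2 (Pi.single z 1) (xA X))
      (fun X w => minimiser (L ^ C.scale X) (fine L (M (C.scale X))) (aK a L (C.scale X))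
        (((L ^ C.scale X : ℕ) : ℝ) ^ 2) m2 (Pi.single w 1) (yA X))
      (fun X => (effLaplacian (L ^ C.scale X) (fine L (M (C.scale X))) (aK a L (C.scale X))
          (((L ^ C.scale X : ℕ) : ℝ) ^ 2) m2 + (a * ((L : ℝ) ^ 2)⁻¹) • blockProj L (M (C.scale X)))⁻¹)
      hκpos.le hsA hsC hsB ?_ hCA ?_ hV hdd EA hEA W
    · intro X z
      obtain ⟨mm, hMK⟩ := hPar X (C.scale X)
      exact H₁ ⟨d, L, mm, C.scale X, hd, hLp⟩ rfl rfl (hsc X) (fine L (M (C.scale X))) hMK (L ^ C.scale X) rfl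
        κ hκpos hκ₁ (xA X) z
    · intro X w
      obtain ⟨mm, hMK⟩ := hPar X (C.scale X)
      exact H₂ ⟨d, L, mm, C.scale X, hd, hLp⟩ rfl rfl (hsc X) (fine L (M (C.scale X))) hMK (L ^ C.scale X) rfl
        κ hκpos hκ₂ (yA X) w
  · -- run B: row and column of `ℋ_{j+n}` on the finer torus; its blocks under `x_B, y_B` are `B(x_A), B(y_A)`
    have hN : ∀ X : C.Dom, L ^ n * L ^ C.scale X = L ^ (C.scale X + n) := fun X => by rw [pow_add, mul_comm]
    refine decayBound_of_threeFactorDecay (C := C) (β := fun j => Tor (fine L (M j))) (P := fun j => Tor (fine L (M j)))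
      (fun j => tdistT (fine L (M j))) (fun j => (tdistT_isPseudoDist _).nonneg)
      (fun j => (tdistT_isPseudoDist _).triangle) (fun _ => id)
      (fun X => blockOf (L ^ C.scale X) (fine L (M (C.scale X))) (xA X))
      (fun X => blockOf (L ^ C.scale X) (fine L (M (C.scale X))) (yA X))
      (fun X z => minimiser (L ^ n * L ^ C.scale X) (fine L (M (C.scale X))) (aK a L (C.scale X + n))
        (((L ^ n * L ^ C.scale X : ℕ) : ℝ) ^ 2) m2 (Pi.single z 1) (xB X))
      (fun X w => minimiser (L ^ n * L ^ C.scale X) (fine L (M (C.scale X))) (aK a L (C.scale X + n))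
        (((L ^ n * L ^ C.scale X : ℕ) : ℝ) ^ 2) m2 (Pi.single w 1) (yB X))
      (fun X => (effLaplacian (L ^ n * L ^ C.scale X) (fine L (M (C.scale X))) (aK a L (C.scale X + n))
          (((L ^ n * L ^ C.scale X : ℕ) : ℝ) ^ 2) m2 + (a * ((L : ℝ) ^ 2)⁻¹) • blockProj L (M (C.scale X)))⁻¹)
      hκpos.le hsA hsC hsB ?_ hCB ?_ hV hdd EB hEB W
    · intro X z
      obtain ⟨mm, hMK⟩ := hPar X (C.scale X + n)
      have h := H₁ ⟨d, L, mm, C.scale X + n, hd, hLp⟩ rfl rfl (show 1 ≤ C.scale X + n by have := hsc X; omega)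
        (fine L (M (C.scale X))) hMK (L ^ n * L ^ C.scale X) (hN X) κ hκpos hκ₁ (xB X) z
      rw [blockOf_over (fine L (M (C.scale X))) (xA X) (xB X) (hx X)] at h
      exact h
    · intro X w
      obtain ⟨mm, hMK⟩ := hPar X (C.scale X + n)
      have h := H₂ ⟨d, L, mm, C.scale X + n, hd, hLp⟩ rfl rfl (show 1 ≤ C.scale X + n by have := hsc X; omega)
        (fine L (M (C.scale X))) hMK (L ^ n * L ^ C.scale X) (hN X) κ hκpos hκ₂ (yB X) w
      rw [blockOf_over (fine L (M (C.scale X))) (yA X) (yB X) (hy X)] at h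
      exact h

/-- **EVERY HYPOTHESIS SHAPE OF `T4OutputRate` §2 INHABITED BY KING'S ACTUAL GRAPHS AT ONE LETTER SET.**  On the binder list
of p418046 (and `0 ≤ γ ≤ 1`) there are `κ > 0`, `A ≥ 0`, `C₅ ≥ 0` (functions of `d, L, a, m², γ` only) such that for every
admissible volume family, carriers, readings, King's two three-factor read-outs and window:
`DecayBound EA W A κ ∧ DecayBound EB W A κ` ((0.25), §2) `∧ NE5 EA EB W κ (L^{−γ∕2}) C₅` ((3.73)'s first bound, p418046
`ne5_kingModel_threeFactor_torus`, brought to the common `κ` by `N18Knit.ne5_mono`) `∧ PrefixDependenceOn EA W ∧ NE9 EA W κ 0 ∧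
LipBackground EA W κ 0` (run A reads neither the couplings nor the background: the history moduli and the background-Lipschitz
modulus are ZERO — `N18Coherence.ne9_zero_of_couplingBlind`, `N18KingModelU3Rung.lipBackground_zero_iff_unreadOn`).  The located
CONTENT is (0.25)'s `κ > 0` with NE5's `θ = L^{−γ∕2} < 1` at the SAME `κ`; the located ABSENCE is the zero letters — what
Bałaban's `V`-dependence adds (p450669 §1) is exactly non-zero `Λ`, `C_U`. [cite: King1986, Thm 3.3 p.658, Prop. 3.9 (3.73) p.665, (4.41)–(4.43) p.675; Balaban1987RG1, (0.24)–(0.25) p.257, (1.18) p.263, §0 p.256, §5 p.298; Balaban1988Convergent, (2.27) p.259] -/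
theorem kingModel_threeFactor_allShapes_torus (hd : 1 ≤ d) (L : ℕ) [NeZero L] (hLp : Odd L ∧ 1 < L) {a m2 : ℝ}
    (ha : 0 < a) (hm : 0 < m2) {γ : ℝ} (hγ0 : 0 ≤ γ) (hγ1 : γ ≤ 1) :
    ∃ κ A C₅ : ℝ, 0 < κ ∧ 0 ≤ A ∧ 0 ≤ C₅ ∧
      ∀ (n : ℕ) (_hn : 1 ≤ n) (M : ℕ → Fin d → ℕ) [∀ j μ, NeZero (M j μ)]
        (_hM : ∀ j, ∃ mm : ℕ, ∀ μ, L * M j μ = 2 * L ^ mm)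
        (C : Carriers) (_hsc : ∀ X, 1 ≤ C.scale X)
        (xA yA : (X : C.Dom) → Tor (fine (L ^ C.scale X) (fine L (M (C.scale X)))))
        (xB yB : (X : C.Dom) → Tor (fine (L ^ n * L ^ C.scale X) (fine L (M (C.scale X)))))
        (_hx : ∀ X μ, (xA X μ).val = (xB X μ).val / L ^ n)
        (_hy : ∀ X μ, (yA X μ).val = (yB X μ).val / L ^ n)
        (_hd : ∀ X, C.d X ≤ tdistT (fine L (M (C.scale X)))
            (blockOf (L ^ C.scale X) (fine L (M (C.scale X))) (xA X))
            (blockOf (L ^ C.scale X) (fine L (M (C.scale X))) (yA X)))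
        (EA : Functional C C.BgA) (EB : Functional C C.BgB)
        (_hEA : ∀ g U X, EA g U X =
          (fun z => minimiser (L ^ C.scale X) (fine L (M (C.scale X))) (aK a L (C.scale X))
              (((L ^ C.scale X : ℕ) : ℝ) ^ 2) m2 (Pi.single z 1) (xA X))
            ⬝ᵥ ((effLaplacian (L ^ C.scale X) (fine L (M (C.scale X))) (aK a L (C.scale X))
                    (((L ^ C.scale X : ℕ) : ℝ) ^ 2) m2
                  + (a * ((L : ℝ) ^ 2)⁻¹) • blockProj L (M (C.scale X)))⁻¹
                *ᵥ fun w => minimiser (L ^ C.scale X) (fine L (M (C.scale X))) (aK a L (C.scale X))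
                    (((L ^ C.scale X : ℕ) : ℝ) ^ 2) m2 (Pi.single w 1) (yA X)))
        (_hEB : ∀ g U X, EB g U X =
          (fun z => minimiser (L ^ n * L ^ C.scale X) (fine L (M (C.scale X))) (aK a L (C.scale X + n))
              (((L ^ n * L ^ C.scale X : ℕ) : ℝ) ^ 2) m2 (Pi.single z 1) (xB X))
            ⬝ᵥ ((effLaplacian (L ^ n * L ^ C.scale X) (fine L (M (C.scale X))) (aK a L (C.scale X + n))
                    (((L ^ n * L ^ C.scale X : ℕ) : ℝ) ^ 2) m2
                  + (a * ((L : ℝ) ^ 2)⁻¹) • blockProj L (M (C.scale X)))⁻¹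
                *ᵥ fun w => minimiser (L ^ n * L ^ C.scale X) (fine L (M (C.scale X))) (aK a L (C.scale X + n))
                    (((L ^ n * L ^ C.scale X : ℕ) : ℝ) ^ 2) m2 (Pi.single w 1) (yB X)))
        (W : Set (ℕ → ℝ)),
        DecayBound EA W A κ ∧ DecayBound EB W A κ ∧ NE5 EA EB W κ ((L : ℝ) ^ (-(γ / 2))) C₅ ∧
          PrefixDependenceOn EA W ∧ NE9 EA W κ (fun _ _ => 0) ∧ LipBackground EA W κ (fun _ _ => 0) := by
  have hL1 : 1 ≤ L := by have := hLp.2; omega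
  obtain ⟨κ₁, A, hκ₁, hA, H1⟩ := decayBound_kingModel_threeFactor_torus hd L hLp ha hm
  obtain ⟨κ₅, C₅, hκ₅, hC₅, H5⟩ := ne5_kingModel_threeFactor_torus hd L hLp ha hm hγ0 hγ1
  refine ⟨min κ₁ κ₅, A, C₅, lt_min hκ₁ hκ₅, hA, hC₅, ?_⟩
  intro n hn M _ hM C hsc xA yA xB yB hx hy hdd EA EB hEA hEB W
  obtain ⟨hA1, hB1⟩ := H1 n hn M hM C hsc xA yA xB yB hx hy hdd EA EB hEA hEB W
  have h5 := H5 n hn M hM C hsc xA yA xB yB hx hy hdd EA EB hEA hEB W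
  have hθ : 0 ≤ (L : ℝ) ^ (-(γ / 2)) := (kingTheta_pos hL1 (γ / 2)).le
  refine ⟨decayBound_mono hA1 subset_rfl (min_le_left _ _) le_rfl,
    decayBound_mono hB1 subset_rfl (min_le_left _ _) le_rfl,
    ne5_mono h5 subset_rfl (min_le_right _ _) hθ le_rfl hC₅ le_rfl, ?_, ?_, ?_⟩
  · intro g _ g' _ U X _
    rw [hEA, hEA]
  · exact ne9_zero_of_couplingBlind (fun g g' U X => by rw [hEA, hEA]) W _
  · exact lipBackground_zero_iff_unreadOn.2 fun g _ U U' X => by rw [hEA, hEA]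

end KingTorus

end Summit.QuantumFields.YangMills.BalabanUVNodes.N18KingModelOneRun

end
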